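import Summits.CriticalPhenomena.SAWScalingLimit.Theorems.SAWTotalPositivityCriticalBubbleBoundKestenHWFloor
import Summits.CriticalPhenomena.SAWScalingLimit.Theorems.SAWTotalPositivityCriticalBubbleBoundKestenHWColumnRenewal
import Summits.CriticalPhenomena.SAWScalingLimit.Theorems.SAWTotalPositivityCriticalBubbleBoundKestenHWStrip
import Summits.CriticalPhenomena.SAWScalingLimit.Theorems.SAWTotalPositivityCriticalBubbleBoundKestenHWStripTransfer
import Mathlib.Analysis.SpecialFunctions.Exp
import HarnessLib

/-!
# Line `kesten-product-renewal-dictionary` for the crux `SAWTotalPositivity.CriticalBubbleBound`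
(stmt-CriticalPhenomena-7117): the floor under B1 and the critical strip mass in RENEWAL currency
`exp(U(h))` (stubs T0, T1, T2)

The line's objects (`Theorems/SAWTotalPositivityCriticalBubbleBoundKestenDefs.lean`, Madras–Slade §4.2):
`u_a = columnMass a` is Kesten's span-renewal density (the critical mass `Σ_{span W = a} x_c^{|W|}` of the
bridges of `ℤ²` of span `a`, each `≤ 1` by Kesten), `L(v) = pinnedLengthMass v` the length-weighted
critical mass of the bridges pinned at `v`, and `U(h) := Σ_{a=1}^{h} u_a` the RENEWAL FUNCTION of
Kesten's renewal process (its `toReal` version `Σ_{a ∈ Icc 1 h} (columnMass a).toReal`).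

Proved here, all unconditional:
* T0 `halfSpaceWordMass_le_exp_renewalSum`: the critical mass of the self-avoiding half-space words of
  length `≤ N` and width `≤ h` is `≤ exp(U(h))`. From the critical Hammersley–Welsh product bound
  `hw_product` (Madras–Slade (3.1.2)–(3.1.4) in generating-function form):
  `HS_{x_c}(N, h) ≤ Π_{a=1}^{h} (1 + B_{a,N}(x_c))`, where the truncated bridge word mass
  `B_{a,N}(x_c) ≤ u_a` (`renewalSum_bridgeWordMass_le_toReal`: a finite partial sum of the `tsum`
  `columnMass_eq_tsum_bridgeWords`), and `1 + u_a ≤ exp(u_a)`;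
* T1 `pinnedLengthMass_le_exp_renewalSum`: `sup_{v₀ = h} L(v) ≤ Λ_h ≤ μ · exp(U(h)) · exp(U(h+1))`,
  by the marked-step splitting `lengthWordMass_le_of_split` with `b₁ = exp(U(h))`, `b₂ = exp(U(h+1))`
  and the transfer to vertex functions of `…KestenHWPinnedExp.lean`;
* T2 `stripMass_le_exp_renewalSum`: the critical generating function of the self-avoiding walks confined
  to a vertical strip of width `h` is `≤ μ · exp(U(h)) · exp(U(h+1))`, by the cut at the last minimum
  `stripCut_mass_le_of_split` and the transfer of `…KestenHWStripTransfer.lean`.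

This replaces the crude factor `2^h` (from `B_{a,N}(x_c) ≤ 1`) of `halfSpaceWordMass_le_two_pow`,
`pinnedLengthMass_le_exp`, `stripMass_le_exp_of` by `exp(U(h))`: the floor under stub B1 is
stretched-exponential in `h` iff the renewal function `U` is sublinear, i.e. iff the mean span of
Kesten's irreducible bridge is infinite (open; conjecturally `U(h) ≍ h^{3/4}`).

Sources: N. Madras, G. Slade, *The Self-Avoiding Walk* (1993), §3.1 (Hammersley–Welsh, (3.1.2)–(3.1.7)),
§4.2 (Kesten's renewal structure, (4.2.1)–(4.2.12)); H. Kesten, J. Math. Phys. 4 (1963), §4.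
-/

noncomputable section

open Literature.Probability.LatticeModels
open Literature.Probability.RandomPlanarGeometry Literature.Probability.RandomPlanarGeometry.SAW
open scoped ENNReal NNReal BigOperators
open Classical

namespace Summit.CriticalPhenomena.SAWScalingLimit.Theorems.CriticalBubbleBound.Kesten.HW

/-! ## The truncated bridge word mass of span `a` is at most `u_a` -/

/-- **`B_{a,N}(x_c) ≤ u_a`**: the critical mass of the self-avoiding bridge words of span `a` and length
`≤ N` is at most Kesten's renewal density `u_a = columnMass a` — a finite partial sum of the `tsum`
`columnMass_eq_tsum_bridgeWords` of non-negative terms (and `u_a ≤ 1 < ∞`, `Cut.columnMass_le_one`).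
[cite: MadrasSlade1993, §4.2, eq. (4.2.9)–(4.2.12)] -/
theorem renewalSum_bridgeWordMass_le_toReal (a N : ℕ) :
    ∑ w ∈ (Finset.range (N + 1)).biUnion
        (fun n => (sawWords n).filter (fun w => IsBridgeW w ∧ xEnd w = (a : ℤ))),
      criticalFugacity ^ w.length ≤ (columnMass a).toReal := by
  have hxc : 0 ≤ criticalFugacity := StripMass.criticalFugacity_pos.le
  have htop : columnMass a ≠ ⊤ := ne_top_of_le_ne_top ENNReal.one_ne_top (Cut.columnMass_le_one a)
  rw [← ENNReal.ofReal_le_iff_le_toReal htop, ENNReal.ofReal_sum_of_nonneg fun w _ => pow_nonneg hxc _,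
    columnMass_eq_tsum_bridgeWords a]
  -- every word of the finite set is a self-avoiding bridge word of span `a`
  have hmem : ∀ w ∈ (Finset.range (N + 1)).biUnion
      (fun n => (sawWords n).filter (fun w => IsBridgeW w ∧ xEnd w = (a : ℤ))),
      IsSAW w ∧ IsBridgeW w ∧ xEnd w = (a : ℤ) := fun w hw =>
    (mem_biUnion_sawWords_filter.1 hw).2
  rw [← Finset.sum_subtype_of_mem (fun w => ENNReal.ofReal (criticalFugacity ^ w.length)) hmem]
  exact ENNReal.sum_le_tsum _

/-! ## T0: the half-space word mass in renewal currency -/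

/-- **Stub T0: `HS_{x_c}(N, h) ≤ exp(U(h))`.** The critical mass of the self-avoiding half-space words of
length `≤ N` whose first coordinate stays `≤ h` is at most `exp(Σ_{a=1}^{h} u_a)`, `u_a = columnMass a`
Kesten's renewal density: the Hammersley–Welsh product bound `hw_product` gives
`≤ Π_{a=1}^{h} (1 + B_{a,N}(x_c))`, each `B_{a,N}(x_c) ≤ u_a` (`renewalSum_bridgeWordMass_le_toReal`), and
`1 + u_a ≤ exp(u_a)`. [cite: MadrasSlade1993, §3.1, eq. (3.1.2)–(3.1.4); §4.2] -/
theorem halfSpaceWordMass_le_exp_renewalSum : ∀ N h : ℕ, (∑ w ∈ (Finset.range (N + 1)).biUnion (fun n => (sawWords n).filter (fun w => Zd.IsHalfSpace w.length (traj w) ∧ Zd.maxLevel w.length (traj w) ≤ (h : ℤ))), criticalFugacity ^ w.length) ≤ Real.exp (∑ a ∈ Finset.Icc 1 h, (columnMass a).toReal) := by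
  intro N h
  have hxc : 0 ≤ criticalFugacity := StripMass.criticalFugacity_pos.le
  refine (hw_product criticalFugacity hxc N h).trans ?_
  rw [Real.exp_sum]
  refine Finset.prod_le_prod (fun a _ => ?_) (fun a _ => ?_)
  · exact add_nonneg zero_le_one (Finset.sum_nonneg fun w _ => pow_nonneg hxc _)
  · calc 1 + ∑ w ∈ (Finset.range (N + 1)).biUnion
            (fun n => (sawWords n).filter (fun w => IsBridgeW w ∧ xEnd w = (a : ℤ))),
            criticalFugacity ^ w.length
        ≤ (columnMass a).toReal + 1 := by
          linarith [renewalSum_bridgeWordMass_le_toReal a N]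
      _ ≤ Real.exp (columnMass a).toReal := Real.add_one_le_exp _

/-! ## T1: the floor under B1 in renewal currency -/

/-- **`Λ^w_N(h) ≤ μ · exp(U(h)) · exp(U(h+1))`** (word model): the length-weighted critical mass of the
self-avoiding bridge words of span `h` and length `≤ N`, by the marked-step splitting
`lengthWordMass_le_of_split` with the half-space bounds `b₁ = exp(U(h))`, `b₂ = exp(U(h+1))` of T0.
[cite: MadrasSlade1993, §3.1; §4.2] -/
theorem renewalSum_spanLengthWordMass_le (N h : ℕ) :
    ∑ w ∈ (Finset.range (N + 1)).biUnion
        (fun n => (sawWords n).filter (fun w => IsBridgeW w ∧ xEnd w = (h : ℤ))),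
      (w.length : ℝ) * criticalFugacity ^ w.length ≤
      connectiveConstant * Real.exp (∑ a ∈ Finset.Icc 1 h, (columnMass a).toReal) *
        Real.exp (∑ a ∈ Finset.Icc 1 (h + 1), (columnMass a).toReal) := by
  rw [mul_assoc]
  refine lengthWordMass_le_of_split (L := (h : ℤ)) (N := N) ?_ ?_ ?_
    (halfSpaceWordMass_le_exp_renewalSum N h) (halfSpaceWordMass_le_exp_renewalSum (N + 1) (h + 1))
  · intro w hw
    simp only [Finset.mem_biUnion, Finset.mem_range, Finset.mem_filter, mem_sawWords] at hw
    obtain ⟨n, hn, ⟨hl, hs⟩, hb, he⟩ := hw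
    exact ⟨hs, hb, he, by omega⟩
  · intro u hs hh hm hl
    simp only [Finset.mem_biUnion, Finset.mem_range, Finset.mem_filter, mem_sawWords]
    exact ⟨u.length, by omega, ⟨rfl, hs⟩, hh, hm⟩
  · intro z hs hh hm hl
    simp only [Finset.mem_biUnion, Finset.mem_range, Finset.mem_filter, mem_sawWords]
    refine ⟨z.length, by omega, ⟨rfl, hs⟩, hh, ?_⟩
    push_cast
    exact hm

/-- **`Λ_h ≤ μ · exp(U(h)) · exp(U(h+1))`** in the line's objects: the length-weighted critical mass of the
bridges of `ℤ²` of span `h`, `Σ_{span W = h} |W| x_c^{|W|}`, transferred from the word bound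
`renewalSum_spanLengthWordMass_le` (the series is the supremum of its partial sums, each bounded through
`sum_range_lengthMass_le_wordSum`). [cite: MadrasSlade1993, §3.1; §4.2] -/
theorem renewalSum_spanLengthMass_le (h : ℕ) :
    (∑' W : Bridge, if W.span = (h : ℤ) then (W.len : ℝ≥0∞) * W.mass else 0) ≤
      ENNReal.ofReal (connectiveConstant * Real.exp (∑ a ∈ Finset.Icc 1 h, (columnMass a).toReal) *
        Real.exp (∑ a ∈ Finset.Icc 1 (h + 1), (columnMass a).toReal)) := by
  rw [spanLengthMass_eq_tsum_sum, ENNReal.tsum_eq_iSup_nat]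
  refine iSup_le fun N => ?_
  calc ∑ n ∈ Finset.range N, ∑ _ω ∈ (Zd.bridges 2 n).filter (fun ω => ω n 0 = (h : ℤ)),
          (n : ℝ≥0∞) * ENNReal.ofReal (criticalFugacity ^ n)
      ≤ ∑ n ∈ Finset.range (N + 1), ∑ _ω ∈ (Zd.bridges 2 n).filter (fun ω => ω n 0 = (h : ℤ)),
          (n : ℝ≥0∞) * ENNReal.ofReal (criticalFugacity ^ n) :=
        Finset.sum_le_sum_of_subset (Finset.range_subset_range.2 (Nat.le_succ N))
    _ = ENNReal.ofReal (∑ n ∈ Finset.range (N + 1),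
          ∑ _ω ∈ (Zd.bridges 2 n).filter (fun ω => ω n 0 = (h : ℤ)),
            (n : ℝ) * criticalFugacity ^ n) :=
        sum_range_lengthMass_eq_ofReal h N
    _ ≤ _ := ENNReal.ofReal_le_ofReal
        ((sum_range_lengthMass_le_wordSum h N).trans (renewalSum_spanLengthWordMass_le N h))

/-- **Stub T1: the floor under B1 in renewal currency, `sup_{v₀ = h} L(v) ≤ μ · exp(U(h)) · exp(U(h+1))`.**
The pinned length-weighted critical bridge mass along column `h` is at most
`μ · exp(Σ_{a=1}^{h} u_a) · exp(Σ_{a=1}^{h+1} u_a)`, `u_a = columnMass a`: `L(v) ≤ Λ_{v₀}`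
(`pinnedLengthMass_le_spanLengthMass`) and `renewalSum_spanLengthMass_le`.
[cite: MadrasSlade1993, §3.1; §4.2] -/
theorem pinnedLengthMass_le_exp_renewalSum : ∀ (h : ℕ) (v : Site 2), v 0 = (h : ℤ) → pinnedLengthMass v ≤ ENNReal.ofReal (connectiveConstant * Real.exp (∑ a ∈ Finset.Icc 1 h, (columnMass a).toReal) * Real.exp (∑ a ∈ Finset.Icc 1 (h + 1), (columnMass a).toReal)) :=
  fun h _ hv => (pinnedLengthMass_le_spanLengthMass hv).trans (renewalSum_spanLengthMass_le h)

/-! ## T2: the critical strip mass in renewal currency -/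

/-- **The critical strip word mass is `≤ μ · exp(U(h)) · exp(U(h+1))`** (word model): the critical mass of
the self-avoiding words of length `≤ N` confined to a vertical strip of width `h`, by the cut at the
last minimum `stripCut_mass_le_of_split` (swap `0 ↔ 2`; the tail has maximum `≤ h`, the reflected
reversed head `≤ h + 1`) with the half-space bounds of T0. [cite: MadrasSlade1993, §3.1, (3.1.7); §4.2] -/
theorem renewalSum_stripWordMass_le (N h : ℕ) :
    ∑ w ∈ (Finset.range (N + 1)).biUnion (fun n => (sawWords n).filter
        (fun w => ∀ i ≤ w.length, ∀ i' ≤ w.length, xAt w i ≤ xAt w i' + (h : ℤ))),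
      criticalFugacity ^ w.length ≤
      connectiveConstant * Real.exp (∑ a ∈ Finset.Icc 1 h, (columnMass a).toReal) *
        Real.exp (∑ a ∈ Finset.Icc 1 (h + 1), (columnMass a).toReal) := by
  -- the letter swap `0 ↔ 2` (reflection in the vertical axis) and its properties
  have hx : ∀ d : Step,
      Step.dx ((fun d : Step => if d = 0 then (2 : Step) else if d = 2 then 0 else d) d) =
        -Step.dx d := by
    decide
  have hy : ∀ d : Step,
      Step.dy ((fun d : Step => if d = 0 then (2 : Step) else if d = 2 then 0 else d) d) =
        Step.dy d := by
    decide
  have hinv : ∀ d : Step, (fun d : Step => if d = 0 then (2 : Step) else if d = 2 then 0 else d)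
      ((fun d : Step => if d = 0 then (2 : Step) else if d = 2 then 0 else d) d) = d := by
    decide
  rw [mul_assoc]
  refine stripCut_mass_le_of_split _ hx hy hinv (h := (h : ℤ)) (N := N) ?_ ?_ ?_
    (halfSpaceWordMass_le_exp_renewalSum N h) (halfSpaceWordMass_le_exp_renewalSum (N + 1) (h + 1))
  · intro w hw
    simp only [Finset.mem_biUnion, Finset.mem_range, Finset.mem_filter, mem_sawWords] at hw
    obtain ⟨n, hn, ⟨hl, hs⟩, hstrip⟩ := hw
    exact ⟨hs, hstrip, by omega⟩
  · intro u hs hh hm hl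
    simp only [Finset.mem_biUnion, Finset.mem_range, Finset.mem_filter, mem_sawWords]
    exact ⟨u.length, by omega, ⟨rfl, hs⟩, hh, hm⟩
  · intro z hs hh hm hl
    simp only [Finset.mem_biUnion, Finset.mem_range, Finset.mem_filter, mem_sawWords]
    refine ⟨z.length, by omega, ⟨rfl, hs⟩, hh, ?_⟩
    push_cast
    exact hm

/-- **Stub T2: the critical strip mass in renewal currency.** The critical generating function of the
self-avoiding walks of `ℤ²` from the origin confined to a vertical strip of width `h`,
`Σ_n #{ω ∈ Zd.saws 2 n : ∀ i i' ≤ n, ω₁(i) ≤ ω₁(i') + h} x_c^n`, is at most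
`μ · exp(Σ_{a=1}^{h} u_a) · exp(Σ_{a=1}^{h+1} u_a)` in `ℝ≥0∞` (the series is the supremum of its partial
sums, each transferred to the word bound `renewalSum_stripWordMass_le` by `sum_range_stripCount_le_wordSum`).
[cite: MadrasSlade1993, §3.1, (3.1.7); §4.2] -/
theorem stripMass_le_exp_renewalSum : ∀ h : ℕ, (∑' n : ℕ, (((Zd.saws 2 n).filter (fun ω => ∀ i ≤ n, ∀ i' ≤ n, ω i 0 ≤ ω i' 0 + (h : ℤ))).card : ℝ≥0∞) * ENNReal.ofReal (criticalFugacity ^ n)) ≤ ENNReal.ofReal (connectiveConstant * Real.exp (∑ a ∈ Finset.Icc 1 h, (columnMass a).toReal) * Real.exp (∑ a ∈ Finset.Icc 1 (h + 1), (columnMass a).toReal)) := by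
  intro h
  rw [ENNReal.tsum_eq_iSup_nat]
  refine iSup_le fun N => ?_
  calc ∑ n ∈ Finset.range N,
          (((Zd.saws 2 n).filter (fun ω => ∀ i ≤ n, ∀ i' ≤ n, ω i 0 ≤ ω i' 0 + (h : ℤ))).card : ℝ≥0∞) *
            ENNReal.ofReal (criticalFugacity ^ n)
      ≤ ∑ n ∈ Finset.range (N + 1),
          (((Zd.saws 2 n).filter (fun ω => ∀ i ≤ n, ∀ i' ≤ n, ω i 0 ≤ ω i' 0 + (h : ℤ))).card : ℝ≥0∞) *
            ENNReal.ofReal (criticalFugacity ^ n) :=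
        Finset.sum_le_sum_of_subset (Finset.range_subset_range.2 (Nat.le_succ N))
    _ = ENNReal.ofReal (∑ n ∈ Finset.range (N + 1),
          (((Zd.saws 2 n).filter (fun ω => ∀ i ≤ n, ∀ i' ≤ n, ω i 0 ≤ ω i' 0 + (h : ℤ))).card : ℝ) *
            criticalFugacity ^ n) :=
        sum_range_stripCount_eq_ofReal h N
    _ ≤ _ := ENNReal.ofReal_le_ofReal
        ((sum_range_stripCount_le_wordSum h N).trans (renewalSum_stripWordMass_le N h))

end Summit.CriticalPhenomena.SAWScalingLimit.Theorems.CriticalBubbleBound.Kesten.HW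

end
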